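import Literature.Geometry.Riemannian.RicciDeTurckShortTime
import Literature.Analysis.PDE.QuasilinearFinal
import HarnessLib

/-!
# Ricci flow: short-time existence (Hamilton 1982, Thm. 4.2) — the discharge
(topic `Geometry/Riemannian`)

`ricciFlow_shortTime_existence_holds` proves the named fact
`Literature.Geometry.Riemannian.ricciFlow_shortTime_existence` (`RicciFlow.lean`): on a closed
manifold every smooth Riemannian metric is the initial value of a smooth solution of the Ricci
flow on some `[0, ε)`. The proof is DeTurck's: `ricciFlow_shortTime_existence_of_quasilinear`
(`RicciDeTurckShortTime.lean`) reduces the statement to short-time existence for quasilinear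
strictly parabolic systems for maps into a vector space (hypothesis `hQL`), which is
`Literature.Analysis.PDE.quasilinear_shortTime_existence` (`Analysis/PDE/QuasilinearFinal.lean`,
proved there from the linear theory by a frozen-coefficient Picard scheme in weighted
maximal-regularity energies).

(This file is a sibling of `RicciFlow.lean`/`RicciFlowProofs.lean`; the discharge cannot live in
either of those because `RicciDeTurckShortTime.lean` imports them.)

## References

* R. S. Hamilton, *Three-manifolds with positive Ricci curvature*, J. Differential Geom. 17
  (1982), 255–306, Thm. 4.2. [Hamilton1982]
* D. M. DeTurck, *Deforming metrics in the direction of their Ricci tensors*, J. Differential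
  Geom. 18 (1983), 157–162. [DeTurck1983]
* P. Topping, *Lectures on the Ricci flow*, LMS Lecture Note Series 325, CUP 2006, §5.2.
  [Topping2006]
* M. E. Taylor, *Partial Differential Equations III*, 2nd ed., Springer 2011, Ch. 15, §7.
  [TaylorPDEIII2011]
-/

universe u v w

namespace Literature.Geometry.Riemannian

open Literature.Analysis.PDE in
/-- **Hamilton's short-time existence theorem for the Ricci flow** (Hamilton 1982, Thm. 4.2;
DeTurck 1983): the named fact `ricciFlow_shortTime_existence` holds.
[cite: Hamilton1982, Thm. 4.2] [cite: DeTurck1983] [cite: Topping2006, Thm. 5.2.1] -/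
theorem ricciFlow_shortTime_existence_holds : ricciFlow_shortTime_existence.{u, v, w} :=
  ricciFlow_shortTime_existence_of_quasilinear
    (fun I _ M _ _ _ _ _ _ _ _ _ _ _ _ _ b 𝒪 h𝒪 P a f ha hf hstruct hP u₀ hu₀ hg₀ ↦
      quasilinear_shortTime_existence I M b 𝒪 h𝒪 P a f ha hf hstruct hP u₀ hu₀ hg₀)

end Literature.Geometry.Riemannian
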